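import Summits.BirchSwinnertonDyer.BirchSwinnertonDyer.Theorems.AlignedTransportAtTwoMainConjectureOfRankZeroBSDAtTwoCyclotomicLayerRankGrowth
import Mathlib.LinearAlgebra.Dimension.Localization
import Mathlib.RingTheory.AdjoinRoot
import Mathlib.RingTheory.IsTensorProduct
import Mathlib.LinearAlgebra.TensorProduct.Tower
import Mathlib.RingTheory.Polynomial.Cyclotomic.Roots
import HarnessLib

/-!
# Route `AlignedTransportAtTwo`, crux C2 `MainConjectureOfRankZeroBSDAtTwo` (stmt-BirchSwinnertonDyer-22298):
# THE LAYER DICHOTOMY — at every layer of ANY `ℤ_p`-tower, EITHER `rank E(K_{n+1}) = rank E(K_n)` OR `Φ_{p^{n+1}}(1+T) ∣ char_Λ X(E/K_∞)`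

HONEST FRAMING (cell `bsd-f1-sign2`, WIDTH-5 attached prover seat `bsd-line-att-p5` gen 36 on line `birth` of the lead `bsd-line-att-p2`;
`--supports` stmt-BirchSwinnertonDyer-22298, closes nothing; BSD is NOT proved by any of this; the crux C2, its verdict «blocked-on
`Rank1Residual.GreenbergMuConjectureIrreducible`» and every registered stub are untouched). THEOREMS ONLY — no `def`, no instance, no named fact,
no `sorry`; print binders exactly the lineage's (`h17` = Kato 17.4 (1)(2) at `2`; `hGZK` only where `rank W(ℚ) = 0` is read from `r_an = 0`).

THE POINT. The layer theorem (`…CyclotomicLayerRankGrowth`) needs `φ(p^{n+1})·t` points of `E(K_{n+1})` killed by the relative norm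
`N_n = ∑_{j<p} γ^{pⁿ j}`. The kernel lattice `A_n = ker N_n ⊆ E(K_{n+1})` is stable under `γ` and on it `Φ_{p^{n+1}}(γ) = N_n = 0`, so `A_n` is a module
over the order `ℤ[X]/(Φ_{p^{n+1}})` and (§1, pure algebra: `ℚ ⊗ A_n` is a vector space over the FIELD `ℚ[X]/(Φ)`) **`φ(p^{n+1}) ∣ rank_ℤ A_n`**. Hence
EITHER `rank A_n = 0` — then rank–nullity for `N_n : E(K_{n+1}) → ι_n(E(K_n))` gives `rank E(K_{n+1}) ≤ rank E(K_n)`, i.e. NO growth in the layer —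
OR `rank A_n ≥ φ(p^{n+1})` and the core of the layer theorem puts `Φ_{p^{n+1}}(1+T)` into `char_Λ X`. No representation theory of `Gal(K_{n+1}/K)`
over `ℚ` is invoked beyond this; no hypothesis on the reduction of `E` at `p`.

* §1 `natDegree_dvd_finrank_of_aeval_eq_zero` — **a finitely generated abelian group with an endomorphism `g` killed by a monic `Φ ∈ ℤ[X]`
  irreducible over `ℚ` has `deg Φ ∣ rank_ℤ`** (`ℚ ⊗_ℤ M` is a `ℚ[X]/(Φ)`-vector space; Mathlib `IsBaseChange.finrank_eq`, `Module.finrank_mul_finrank`,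
  `AdjoinRoot.powerBasis`); `totient_dvd_finrank_of_aeval_cyclotomic_eq_zero` (`Φ = Φ_m`, Mathlib `cyclotomic.irreducible_rat`).
* §2 `mordellWeilRank_layer_le_succ` — `rank E(K_n) ≤ rank E(K_{n+1})` in any `ℤ_p`-tower (`ι_n(E(K_n)) ⊆ ι_{n+1}(E(K_{n+1}))` in `E(K̄)`).
* §3 ★★★ `mordellWeilRank_layer_succ_eq_or_cyclotomicLayer_dvd` — **for `E/K` elliptic over a number field, ANY `ℤ_p`-extension with topological
  generator `γ`, any dual datum with `X` finitely generated and torsion, `f ∈ char_Λ X`, and every `n`: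
  `rank E(K_{n+1}) = rank E(K_n)` OR `Φ_{p^{n+1}}(1+T) ∣ f`**; `_of_isCyclotomic` (no finiteness hypothesis over the cyclotomic tower).
  Read contrapositively: the layers at which the rank grows are among the `n+1` with `Φ_{p^{n+1}}(1+T) ∣ f_X` — finitely many, of total degree `≤ λ(X)`.
* The `a₂ = +1` ROAD consequences (`λ₂ ≠ 2ⁿ + 1 ⇒ rank W(ℚ_{n+1}) = rank W(ℚ_n)`; `λ₂ − 1` not a power of two ⇒ the rank is STATIONARY above `ℚ(√2)`)
  are in the companion `…CyclotomicLayerRoadStationary` (which also imports `…CyclotomicLayerRoad`).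

References: R. Greenberg, LNM 1716 (1999), Thm. 1.9 (p. 63), §5 p. 132 and p. 177 [GreenbergLNM1716]; K. Kato, Astérisque 295 (2004), Thm. 17.4
[Kato2004Asterisque]; L. Washington, GTM 83, §13.1–13.2 [Washington1997]; M. Kurihara, R. Pollack, in: L-functions and Galois representations
(2007), §3.1 (the factor `Φ_n^{e_n−1}` bookkeeping of rank growth in `ℚ_∞`) [KuriharaPollack2007].
-/

set_option linter.dupNamespace false
set_option autoImplicit false

noncomputable section

open scoped Classical TensorProduct Polynomial

namespace Summit.BirchSwinnertonDyer.BirchSwinnertonDyer.Theorems.AlignedTransportAtTwoCyclotomicLayerRankDichotomy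

open Polynomial WeierstrassCurve Literature.NumberTheory.EllipticCurves
  Summit.BirchSwinnertonDyer.Rank1Residual.X1.MuLambda
  Summit.BirchSwinnertonDyer.Rank1Residual.Iwasawa
  Summit.BirchSwinnertonDyer.BirchSwinnertonDyer.Theorems.AlignedTransportAtTwoCyclotomicLayerNorm
  Summit.BirchSwinnertonDyer.BirchSwinnertonDyer.Theorems.AlignedTransportAtTwoCyclotomicLayerRankGrowth

universe u

/-! ## §1 Pure algebra: an endomorphism killed by an irreducible polynomial of degree `d` forces `d ∣ rank_ℤ` -/

/-- ★ **`deg Φ ∣ rank_ℤ M`** for a finitely generated abelian group `M` with an endomorphism `g` such that `Φ(g) = 0`, `Φ ∈ ℤ[X]` monic and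
irreducible over `ℚ`: `V = ℚ ⊗_ℤ M` is a vector space over the FIELD `K = ℚ[X]/(Φ)` (acting through `g`), so
`rank_ℤ M = dim_ℚ V = [K:ℚ]·dim_K V = deg Φ · dim_K V`. (The representation-theoretic sentence «`E(F) ⊗ ℚ ≅ ρ^t`» of Greenberg, p. 132, for any lattice.)
[cite: GreenbergLNM1716, §5 p. 132] -/
theorem natDegree_dvd_finrank_of_aeval_eq_zero {M : Type*} [AddCommGroup M] [Module.Finite ℤ M]
    (g : Module.End ℤ M) {Φ : ℤ[X]} (hΦ : Φ.Monic) (hirr : Irreducible (Φ.map (Int.castRingHom ℚ)))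
    (hg : Polynomial.aeval g Φ = 0) : Φ.natDegree ∣ Module.finrank ℤ M := by
  set Φq : ℚ[X] := Φ.map (Int.castRingHom ℚ) with hΦq
  -- the base change `V = ℚ ⊗ M` and `g_V`
  let gV : Module.End ℚ (ℚ ⊗[ℤ] M) := g.baseChange ℚ
  have hgV' : Polynomial.aeval gV Φ = 0 := by
    have h := Polynomial.aeval_algHom_apply (Module.End.baseChangeHom ℤ ℚ M) g Φ
    rw [hg, map_zero] at h
    exact h
  have hgV : Polynomial.aeval gV Φq = 0 := by
    rw [hΦq, show Int.castRingHom ℚ = algebraMap ℤ ℚ from rfl, Polynomial.aeval_map_algebraMap]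
    exact hgV'
  -- `K = ℚ[X]/(Φ)` is a field of degree `deg Φ`, acting on `V` through `g_V`
  haveI : Fact (Irreducible Φq) := ⟨hirr⟩
  have hΦq0 : Φq ≠ 0 := hirr.ne_zero
  let φ : AdjoinRoot Φq →ₐ[ℚ] Module.End ℚ (ℚ ⊗[ℤ] M) :=
    Ideal.Quotient.liftₐ (Ideal.span {Φq}) (Polynomial.aeval gV) (by
      intro a ha
      obtain ⟨b, rfl⟩ := Ideal.mem_span_singleton'.mp ha
      rw [map_mul, hgV, mul_zero])
  letI : Module (AdjoinRoot Φq) (ℚ ⊗[ℤ] M) :=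
    Module.compHom (ℚ ⊗[ℤ] M) (φ : AdjoinRoot Φq →+* Module.End ℚ (ℚ ⊗[ℤ] M))
  haveI : IsScalarTower ℚ (AdjoinRoot Φq) (ℚ ⊗[ℤ] M) := by
    refine ⟨fun q k v ↦ ?_⟩
    change φ (q • k) v = q • φ k v
    rw [map_smul]
    rfl
  have hK : Module.finrank ℚ (AdjoinRoot Φq) = Φ.natDegree := by
    rw [(AdjoinRoot.powerBasis hΦq0).finrank, AdjoinRoot.powerBasis_dim, hΦq, hΦ.natDegree_map]
  have hV : Module.finrank ℚ (ℚ ⊗[ℤ] M) = Module.finrank ℤ M := (TensorProduct.isBaseChange ℤ M ℚ).finrank_eq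
  have htower := Module.finrank_mul_finrank ℚ (AdjoinRoot Φq) (ℚ ⊗[ℤ] M)
  refine ⟨Module.finrank (AdjoinRoot Φq) (ℚ ⊗[ℤ] M), ?_⟩
  rw [← hV, ← htower, hK]

/-- **`φ(m) ∣ rank_ℤ M`** for a finitely generated abelian group with an endomorphism `g` such that `Φ_m(g) = 0` (`Φ_m` irreducible over `ℚ`,
Mathlib `cyclotomic.irreducible_rat`): a finitely generated `ℤ[ζ_m]`-module has `ℤ`-rank divisible by `φ(m)`. [folklore] -/
theorem totient_dvd_finrank_of_aeval_cyclotomic_eq_zero {M : Type*} [AddCommGroup M] [Module.Finite ℤ M]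
    (g : Module.End ℤ M) {m : ℕ} (hm : 0 < m) (hg : Polynomial.aeval g (cyclotomic m ℤ) = 0) :
    m.totient ∣ Module.finrank ℤ M := by
  have h := natDegree_dvd_finrank_of_aeval_eq_zero g (cyclotomic.monic m ℤ)
    (by rw [map_cyclotomic_int]; exact cyclotomic.irreducible_rat hm) hg
  rwa [natDegree_cyclotomic] at h

/-! ## §2 `rank E(K_n) ≤ rank E(K_{n+1})` in any `ℤ_p`-tower -/

section Tower

variable {K : Type u} [Field K] [NumberField K] (W : WeierstrassCurve K) [W.IsElliptic] {p : ℕ} [hp : Fact p.Prime]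
  (κ : ZpExtension K p)

/-- **The Mordell–Weil rank does not drop in a `ℤ_p`-tower**: `rank E(K_n) ≤ rank E(K_{n+1})` (`ι_n(E(K_n)) ⊆ ι_{n+1}(E(K_{n+1}))` inside `E(K̄)`:
a point fixed by `Gal(K̄/K_n)` is fixed by the smaller `Gal(K̄/K_{n+1})` and descends to `K_{n+1}`, tree `exists_layerPointsMap_eq`; both `ι` are
injective). [cite: Washington1997, §13.1] [cite: GreenbergLNM1716, §1 p. 63] -/
theorem mordellWeilRank_layer_le_succ (n : ℕ) :
    (W.baseChange (κ.layer n)).mordellWeilRank ≤ (W.baseChange (κ.layer (n + 1))).mordellWeilRank := by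
  letI : ∀ m, DecidableEq (κ.layer m) := fun m a b ↦ Classical.propDecidable (a = b)
  haveI : FiniteDimensional K (κ.layer (n + 1)) := κ.finiteDimensional_layer_holds (n + 1)
  haveI : NumberField (κ.layer (n + 1)) := NumberField.of_module_finite K (κ.layer (n + 1))
  haveI := (W.baseChange (κ.layer (n + 1))).module_finite_point_holds
  have hle : LinearMap.range (layerPointsMap W κ n).toIntLinearMap ≤ LinearMap.range (layerPointsMap W κ (n + 1)).toIntLinearMap := by
    rintro _ ⟨Q, rfl⟩
    obtain ⟨P, hP⟩ := exists_layerPointsMap_eq W κ (n + 1) (layerPointsMap W κ n Q)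
      fun σ hσ ↦ smul_layerPointsMap W κ n Q σ (κ.layerSubgroup_antitone n.le_succ hσ)
    exact ⟨P, hP⟩
  unfold WeierstrassCurve.mordellWeilRank
  rw [← LinearMap.finrank_range_of_inj (f := (layerPointsMap W κ n).toIntLinearMap) (layerPointsMap_injective W κ n),
    ← LinearMap.finrank_range_of_inj (f := (layerPointsMap W κ (n + 1)).toIntLinearMap) (layerPointsMap_injective W κ (n + 1))]
  exact Submodule.finrank_mono hle

/-- Iterated: `rank E(K_n) ≤ rank E(K_m)` for `n ≤ m`. [cite: Washington1997, §13.1] -/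
theorem mordellWeilRank_layer_mono {n m : ℕ} (hnm : n ≤ m) :
    (W.baseChange (κ.layer n)).mordellWeilRank ≤ (W.baseChange (κ.layer m)).mordellWeilRank := by
  induction hnm with
  | refl => exact le_rfl
  | step _ ih => exact ih.trans (mordellWeilRank_layer_le_succ W κ _)

end Tower

/-! ## §3 The layer dichotomy: `rank E(K_{n+1}) = rank E(K_n)` or `Φ_{p^{n+1}}(1+T) ∣ char_Λ X` -/

section Dichotomy

variable {K : Type u} [Field K] [NumberField K] (W : WeierstrassCurve K) [W.IsElliptic] {p : ℕ} [hp : Fact p.Prime]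
  {κ : ZpExtension K p} {γ : Field.absoluteGaloisGroup K}

/-- ★★★ **THE LAYER DICHOTOMY** (with the divisibility of `E(K̄)` as hypothesis `hdiv`, discharged below). For `E/K` elliptic over a number field,
ANY `ℤ_p`-extension `κ` with topological generator `γ`, a dual datum `D` with `X` finitely generated and torsion, `f ∈ char_Λ X`, and every `n`:
**`rank E(K_{n+1}) = rank E(K_n)` OR `Φ_{p^{n+1}}(1+T) ∣ f`.** PROOF. `N_n = ∑_{j<p} γ^{pⁿ j} : E(K_{n+1}) → ι_n(E(K_n))` (companion `…CyclotomicLayerNorm`),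
`A_n = ker N_n`; `γ` preserves `A_n` (`γ` commutes with `N_n`) and `Φ_{p^{n+1}}(γ)|_{A_n} = N_n|_{A_n} = 0` (`Φ_{p^{n+1}} = ∑_{j<p} X^{pⁿ j}`), so
`pⁿ(p−1) ∣ rank A_n` (§1). If `rank A_n = 0`, rank–nullity gives `rank E(K_{n+1}) = rank N_n(E(K_{n+1})) ≤ rank E(K_n)`, and equality by §2. Otherwise
`rank A_n ≥ pⁿ(p−1)` points of `A_n` with dual functionals (tree `exists_points_functionals_of_le`) feed the core of the layer theorem
(`cyclotomicLayer_pow_dvd_of_mem_charIdeal_of_points_functionals`, `t = 1`). [cite: GreenbergLNM1716, §5 p. 132 and Thm. 1.9 (p. 63)] -/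
theorem mordellWeilRank_layer_succ_eq_or_cyclotomicLayer_dvd_of (hdiv : W.zsmul_geomPoints_surjective)
    (hγ : κ.IsTopGenerator γ) (D : W.SelmerDualData κ γ) [Module.Finite (IwasawaAlgebra p) D.X]
    (hD : D.IsTorsion) {f : IwasawaAlgebra p} (hf : f ∈ D.charIdeal) (n : ℕ) :
    (W.baseChange (κ.layer (n + 1))).mordellWeilRank = (W.baseChange (κ.layer n)).mordellWeilRank ∨
      (((cyclotomic (p ^ (n + 1)) ℤ_[p]).comp (X + 1) : ℤ_[p][X]) : PowerSeries ℤ_[p]) ∣ f := by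
  -- ONE classical `DecidableEq` for every layer (the tree's instance on `E(K_m)`)
  letI : ∀ m, DecidableEq (κ.layer m) := fun m a b ↦ Classical.propDecidable (a = b)
  haveI : FiniteDimensional K (κ.layer (n + 1)) := κ.finiteDimensional_layer_holds (n + 1)
  haveI : NumberField (κ.layer (n + 1)) := NumberField.of_module_finite K (κ.layer (n + 1))
  haveI : FiniteDimensional K (κ.layer n) := κ.finiteDimensional_layer_holds n
  haveI : NumberField (κ.layer n) := NumberField.of_module_finite K (κ.layer n)
  haveI := (W.baseChange (κ.layer (n + 1))).module_finite_point_holds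
  haveI := (W.baseChange (κ.layer n)).module_finite_point_holds
  -- the relative norm `N_n : E(K_{n+1}) → E(K̄)` and its kernel lattice `A_n`
  let Nend : geomPoints W →+ geomPoints W :=
    { toFun := fun Q ↦ ∑ j ∈ Finset.range p, γ ^ (p ^ n * j) • Q
      map_zero' := by simp
      map_add' := fun Q Q' ↦ by simp [Finset.sum_add_distrib] }
  let N := Nend.comp (layerPointsMap W κ (n + 1))
  have hN : ∀ P, N P = ∑ j ∈ Finset.range p, γ ^ (p ^ n * j) • layerPointsMap W κ (n + 1) P := fun _ ↦ rfl
  set φ := N.toIntLinearMap with hφ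
  let A := LinearMap.ker φ
  have hmemA : ∀ {P}, P ∈ A ↔ ∑ j ∈ Finset.range p, γ ^ (p ^ n * j) • layerPointsMap W κ (n + 1) P = 0 := fun {P} ↦ by
    rw [LinearMap.mem_ker]; exact Iff.rfl
  -- `γ` preserves `A_n`
  let g := (layerGal W κ (n + 1) γ).toIntLinearMap
  have hgA : ∀ P ∈ A, g P ∈ A := by
    intro P hP
    rw [hmemA] at hP ⊢
    change ∑ j ∈ Finset.range p, γ ^ (p ^ n * j) • layerPointsMap W κ (n + 1) (layerGal W κ (n + 1) γ P) = 0
    simp_rw [layerPointsMap_layerGal, smul_smul, ← pow_succ, pow_succ', mul_smul, ← Finset.smul_sum, hP, smul_zero]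
  let gA : Module.End ℤ A := g.restrict hgA
  -- `Φ_{p^{n+1}}(γ) = ∑_{j<p} γ^{pⁿ j}` vanishes on `A_n`
  have hpow : ∀ (k : ℕ) (a : A), ((gA ^ k) a : (W.baseChange (κ.layer (n + 1))).toAffine.Point) = (layerGal W κ (n + 1) γ)^[k] a := by
    intro k a
    induction k with
    | zero => rfl
    | succ k ih => rw [pow_succ', Module.End.mul_apply, Function.iterate_succ_apply', ← ih]; rfl
  have haeval : Polynomial.aeval gA (cyclotomic (p ^ (n + 1)) ℤ) = 0 := by
    ext a
    rw [cyclotomic_prime_pow_eq_geom_sum hp.out, map_sum, LinearMap.coe_sum, Finset.sum_apply, LinearMap.zero_apply,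
      Submodule.coe_zero, AddSubmonoidClass.coe_finsetSum]
    simp_rw [← pow_mul, map_pow, Polynomial.aeval_X, hpow, layerGal_iterate_apply, pow_mul, ← layerGal_iterate_apply]
    exact sum_layerGal_iterate_eq_zero_of_relNorm_eq_zero W κ γ n (hmemA.mp a.2)
  have hdvdA : p ^ n * (p - 1) ∣ Module.finrank ℤ A := by
    have h := totient_dvd_finrank_of_aeval_cyclotomic_eq_zero gA (pow_pos hp.out.pos (n + 1)) haeval
    rwa [Nat.totient_prime_pow_succ hp.out] at h
  -- rank–nullity for `N_n`
  have h1 := Submodule.finrank_quotient_add_finrank (LinearMap.ker φ)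
  rw [φ.quotKerEquivRange.finrank_eq] at h1
  have h2 : Module.finrank ℤ (LinearMap.range φ) ≤ (W.baseChange (κ.layer n)).mordellWeilRank := by
    have hle : LinearMap.range φ ≤ LinearMap.range (layerPointsMap W κ n).toIntLinearMap := by
      rintro _ ⟨P, rfl⟩
      obtain ⟨Q, hQ⟩ := exists_layerPoints_eq_relNorm W κ n hγ P
      exact ⟨Q, hQ.trans (hN P).symm⟩
    unfold WeierstrassCurve.mordellWeilRank
    rw [← LinearMap.finrank_range_of_inj (f := (layerPointsMap W κ n).toIntLinearMap) (layerPointsMap_injective W κ n)]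
    exact Submodule.finrank_mono hle
  obtain ⟨c, hc⟩ := hdvdA
  rcases Nat.eq_zero_or_pos c with rfl | hcpos
  · -- `rank A_n = 0`: no growth
    left
    refine le_antisymm ?_ (mordellWeilRank_layer_le_succ W κ n)
    unfold WeierstrassCurve.mordellWeilRank at h2 ⊢
    change Module.finrank ℤ _ + Module.finrank ℤ A = Module.finrank ℤ _ at h1
    rw [mul_zero] at hc
    omega
  · -- `rank A_n ≥ pⁿ(p−1)`: the layer prime divides `char X`
    right
    have hr : p ^ n * (p - 1) * 1 ≤ Module.finrank ℤ A := by
      rw [mul_one, hc]; exact Nat.le_mul_of_pos_right _ hcpos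
    obtain ⟨P, lam, N₀, hN₀, hPA, hlam⟩ := exists_points_functionals_of_le A
    have h := cyclotomicLayer_pow_dvd_of_mem_charIdeal_of_points_functionals W hdiv hγ D hD hf n hr P lam N₀ hN₀
      (fun i ↦ sum_layerGal_iterate_eq_zero_of_relNorm_eq_zero W κ γ n (hmemA.mp (hPA i))) hlam
    rwa [pow_one] at h

/-- ★★★ **THE LAYER DICHOTOMY, UNCONDITIONALLY**: for `E/K` elliptic over a number field, ANY `ℤ_p`-extension `K_∞ = ⋃ K_n` with topological generator `γ`,
any Pontryagin-dual datum of `Sel_{p^∞}(E/K_∞)` with `X` finitely generated and `Λ`-torsion, every `f ∈ char_Λ X` and every `n`: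
**`rank_ℤ E(K_{n+1}) = rank_ℤ E(K_n)` OR `Φ_{p^{n+1}}(1+T) ∣ f`.** Equivalently: the set of layers `n+1` at which the Mordell–Weil rank grows is
contained in `{n+1 : Φ_{p^{n+1}}(1+T) ∣ f_X}` — finite, of total degree `∑ pⁿ(p−1) ≤ λ(X)`. No reduction hypothesis at `p`, no cyclotomicity.
[cite: GreenbergLNM1716, §5 p. 132 and Thm. 1.9 (p. 63)] -/
theorem mordellWeilRank_layer_succ_eq_or_cyclotomicLayer_dvd (hγ : κ.IsTopGenerator γ) (D : W.SelmerDualData κ γ)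
    [Module.Finite (IwasawaAlgebra p) D.X] (hD : D.IsTorsion) {f : IwasawaAlgebra p} (hf : f ∈ D.charIdeal) (n : ℕ) :
    (W.baseChange (κ.layer (n + 1))).mordellWeilRank = (W.baseChange (κ.layer n)).mordellWeilRank ∨
      (((cyclotomic (p ^ (n + 1)) ℤ_[p]).comp (X + 1) : ℤ_[p][X]) : PowerSeries ℤ_[p]) ∣ f :=
  mordellWeilRank_layer_succ_eq_or_cyclotomicLayer_dvd_of W W.zsmul_geomPoints_surjective_holds hγ D hD hf n

/-- Generator form: `char_Λ X = (f_E)`: `rank E(K_{n+1}) = rank E(K_n)` or `Φ_{p^{n+1}}(1+T) ∣ f_E`. [cite: GreenbergLNM1716, §5 p. 132] -/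
theorem mordellWeilRank_layer_succ_eq_or_cyclotomicLayer_dvd_charGen (hγ : κ.IsTopGenerator γ) (D : W.SelmerDualData κ γ)
    [Module.Finite (IwasawaAlgebra p) D.X] (hD : D.IsTorsion) {fE : IwasawaAlgebra p} (hfE : D.charIdeal = Ideal.span {fE}) (n : ℕ) :
    (W.baseChange (κ.layer (n + 1))).mordellWeilRank = (W.baseChange (κ.layer n)).mordellWeilRank ∨
      (((cyclotomic (p ^ (n + 1)) ℤ_[p]).comp (X + 1) : ℤ_[p][X]) : PowerSeries ℤ_[p]) ∣ fE :=
  mordellWeilRank_layer_succ_eq_or_cyclotomicLayer_dvd W hγ D hD (hfE ▸ Ideal.mem_span_singleton_self fE) n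

/-- **Cyclotomic tower over a number field, no finiteness hypothesis** (`X` is finitely generated over `Λ` unconditionally there).
[cite: GreenbergLNM1716, §5 p. 132 and §1 p. 60] -/
theorem mordellWeilRank_layer_succ_eq_or_cyclotomicLayer_dvd_of_isCyclotomic (hκ : κ.IsCyclotomic) (hγ : κ.IsTopGenerator γ)
    (D : W.SelmerDualData κ γ) (hD : D.IsTorsion) {fE : IwasawaAlgebra p} (hfE : D.charIdeal = Ideal.span {fE}) (n : ℕ) :
    (W.baseChange (κ.layer (n + 1))).mordellWeilRank = (W.baseChange (κ.layer n)).mordellWeilRank ∨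
      (((cyclotomic (p ^ (n + 1)) ℤ_[p]).comp (X + 1) : ℤ_[p][X]) : PowerSeries ℤ_[p]) ∣ fE := by
  haveI : Module.Finite (IwasawaAlgebra p) D.X := D.module_finite_of_isCyclotomic W κ hκ hγ
  exact mordellWeilRank_layer_succ_eq_or_cyclotomicLayer_dvd_charGen W hγ D hD hfE n

end Dichotomy



end Summit.BirchSwinnertonDyer.BirchSwinnertonDyer.Theorems.AlignedTransportAtTwoCyclotomicLayerRankDichotomy
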